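import Literature.IUT.HodgeTheaters.Cor53iFcircHdescOfAutDescendsModInner
import Literature.IUT.HodgeTheaters.GlobalFrobenioidsPushCarrierGaloisRich
import Literature.AnabelianGeometry.AbsoluteAnabelian.NFGaloisNotTFGProofs
import HarnessLib

/-!
# [IUTchI] Cor 5.3 (i) «resp. ⊚»: `hdesc⊚` is FALSE at the push carrier of `pr₁ : G_F × G_F ↠ G_F` — the law `AutCompatible ι` is load-bearing

S. Mochizuki, *Inter-universal Teichmüller theory I*, kurims manuscript (May 2020), §5 Cor 5.3 (i) p. 144 l. 2–11; Example 5.1 (i) p. 123,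
(iii) pp. 125–126 ([IUTchI] Cor 5.3 (i) p.144) [claim: Mochizuki2012, status: disputed] (D-0012 claim key; nothing of the series is asserted;
no side taken on [IUTchIII] Cor. 3.12).  [FrdII] Ex 1.3 (ii) p. 11 (`φ_*`, pull-back) [cite: MochizukiFrdII2008, Ex 1.3 (ii) p.11].
PROOF-ONLY NV file (cell abc-iut, seat abc-iut-L5-t4 gen 10, banked «HDESC-FALSE@PR1» twin of row «HDESC@OPEN-EMBEDDING mod NU», abc-iut-L5-lead
RULINGS #204/#211; 0 def · 0 instance · no Prop fact).  ★ `GlobalFrobenioid.hdesc_of_autCompatible` (any open `ι`) and abc-iut-L5-t1's ★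
`hdesc_of_autDescendsModInner` (`ρ` surjective) derive abc-iut-w4-d109's displayed binder `hdesc⊚` from the LAW «topological automorphisms
extend along `ι` up to `Inn`».  THIS FILE: the law is LOAD-BEARING — at the continuous open surjection `pr₁ : G × G ↠ G` (`G` with a proper
open subgroup) the CONCLUSION `hdesc⊚` itself FAILS (§1: the factor swap of `CosetCat (G × G)` descends along `push pr₁` to no self-equivalence
of `CosetCat G`; §2: for every `⊚`-record over `push pr₁` up to equivalences; §3: at the LITERAL carrier `H := G_F × G_F`, `ι := pr₁` of ★
`GlobalFrobenioidsPushCarrierGaloisRich` §4, every record, every `Δ`, NO hypothesis).  HONEST LABEL: a tightness witness for the cell's TYPED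
law at one of OUR carriers; print's `†𝒟^⊚ → †𝒟^⊛` is an open INJECTION of `π₁`'s (there `hdesc⊚` is PROVED mod NU + `Normal ℚ F`, ★
`Cor53iFcircBijectiveAtOpenEmbedding`), not `pr₁`; nothing here bears on print's proof route or on `hlift⊚`; nothing asserts abc proved or refuted. -/

noncomputable section

namespace Literature.AnabelianGeometry.SemiGraphs.CosetCat

open CategoryTheory Function

universe u

variable {G : Type u} [Group G] [TopologicalSpace G]

/-- A `G`-map `G/G → G/V` forces `V = G` (its point `a·V` is fixed by all of `G`). [cite: MochizukiFrdII2008, Ex 1.3 (i) p.11] -/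
theorem mem_sg_of_hom_top {Y : CosetCat G} (f : top ⟶ Y) (g : G) : g ∈ Y.sg := by
  obtain ⟨a, ha⟩ := Quotient.exists_rep (pt f)
  have ha' : pt f = ((a : G) : Y.carrier) := ha.symm
  have hfix : ∀ u : G, ((u * a : G) : Y.carrier) = ((a : G) : Y.carrier) := fun u => by
    have h := smul_pt f (OpenSubgroup.mem_top u : u ∈ (top : CosetCat G).sg)
    rwa [ha', MulAction.Quotient.smul_coe, smul_eq_mul] at h
  have h := QuotientGroup.eq.mp (hfix (a * g⁻¹ * a⁻¹))
  rwa [show (a * g⁻¹ * a⁻¹ * a)⁻¹ * a = g by group] at h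

/-- **Not every self-equivalence of `CosetCat (G × G)` descends along `push pr₁`** (`V ≠ G` open): `swap^*` does not — `push pr₁` sends
`swap^*((G×G)/(V×G))` to `G/G` but `(G×G)/(V×G)` to `G/V`, and a (full) descended `Θ₀` would give a `G`-map `G/G → G/V`. [cite: MochizukiFrdII2008, Ex 1.3 (ii) p.11] -/
theorem not_forall_descends_push_fst (V : OpenSubgroup G) (hV : ∃ g : G, g ∉ V) :
    ¬ ∀ Θ : CosetCat (G × G) ≌ CosetCat (G × G), ∃ Θ₀ : CosetCat G ≌ CosetCat G,
      Nonempty (Θ.functor ⋙ push (MonoidHom.fst G G) isOpenMap_fst ≅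
        push (MonoidHom.fst G G) isOpenMap_fst ⋙ Θ₀.functor) := by
  intro h
  obtain ⟨g₀, hg₀⟩ := hV
  let ψ : G × G ≃ₜ* G × G :=
    { MulEquiv.prodComm with continuous_toFun := continuous_swap, continuous_invFun := continuous_swap }
  haveI := pull_isEquivalence_of_continuousMulEquiv ψ
  obtain ⟨Θ₀, ⟨σ⟩⟩ := h (pull ψ.toMonoidHom ψ.continuous ψ.surjective).asEquivalence
  let X : CosetCat (G × G) := ⟨V.prod ⊤⟩
  -- `push pr₁ (swap^* X) = G/G`: every `g = pr₁ (g, 1)` with `swap (g, 1) = (1, g) ∈ V × G`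
  have hfull : ∀ g : G, g ∈ ((push (MonoidHom.fst G G) isOpenMap_fst).obj
      ((pull ψ.toMonoidHom ψ.continuous ψ.surjective).obj X)).sg := fun g =>
    (mem_mapOpen (MonoidHom.fst G G) isOpenMap_fst).mpr ⟨(g, 1), ⟨V.one_mem, OpenSubgroup.mem_top g⟩, rfl⟩
  -- `Θ₀ (G/G) → G/G = push pr₁ (swap^* X) ⥲ Θ₀ (push pr₁ X)`, `Θ₀` full ⇒ `G/G → push pr₁ X = G/V` ⇒ `g₀ ∈ V`
  have k : Θ₀.functor.obj top ⟶ (push (MonoidHom.fst G G) isOpenMap_fst).obj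
      ((pull ψ.toMonoidHom ψ.continuous ψ.surjective).obj X) :=
    homMk ((1 : G) : CosetCat.carrier _) fun u _ => by
      rw [MulAction.Quotient.smul_coe, QuotientGroup.eq]
      exact hfull _
  obtain ⟨π, hπ, hπ₀⟩ := (mem_mapOpen (MonoidHom.fst G G) isOpenMap_fst).mp
    (mem_sg_of_hom_top (Θ₀.fullyFaithfulFunctor.preimage (k ≫ σ.hom.app X)) g₀)
  exact hg₀ (hπ₀ ▸ hπ.1)

end Literature.AnabelianGeometry.SemiGraphs.CosetCat

namespace Literature.IUT.HodgeTheaters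

open CategoryTheory Function Literature.AlgebraicGeometry.Frobenioids Literature.AnabelianGeometry.SemiGraphs

universe v₁ v₂ v₃ v₄ u₁ u₂ u₃ u₄ u

/-- The square of ★ `CatIsomorphism.descends_of_equivalences` REVERSED: `P' ⋙ i ≅ e ⋙ P` gives `P ⋙ i⁻¹ ≅ e⁻¹ ⋙ P'`.
([IUTchI] §0 p.33) [claim: Mochizuki2012, status: disputed] -/
theorem CatIsomorphism.nonempty_compat_symm {C : Type u₁} [Category.{v₁} C] {D : Type u₂} [Category.{v₂} D]
    {C' : Type u₃} [Category.{v₃} C'] {D' : Type u₄} [Category.{v₄} D'] (P : C ⥤ D) (P' : C' ⥤ D') (e : C' ≌ C) (i : D' ≌ D)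
    (compat : P' ⋙ i.functor ≅ e.functor ⋙ P) : Nonempty (P ⋙ i.symm.functor ≅ e.symm.functor ⋙ P') :=
  ⟨calc P ⋙ i.inverse ≅ 𝟭 _ ⋙ (P ⋙ i.inverse) := (Functor.leftUnitor _).symm
      _ ≅ (e.inverse ⋙ e.functor) ⋙ (P ⋙ i.inverse) := Functor.isoWhiskerRight e.counitIso.symm _
      _ ≅ e.inverse ⋙ (e.functor ⋙ P) ⋙ i.inverse :=
        Functor.associator _ _ _ ≪≫ Functor.isoWhiskerLeft e.inverse (Functor.associator _ _ _).symm
      _ ≅ e.inverse ⋙ (P' ⋙ i.functor) ⋙ i.inverse := Functor.isoWhiskerLeft e.inverse (Functor.isoWhiskerRight compat.symm _)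
      _ ≅ e.inverse ⋙ P' ⋙ (i.functor ⋙ i.inverse) := Functor.isoWhiskerLeft e.inverse (Functor.associator _ _ _)
      _ ≅ e.inverse ⋙ P' ⋙ 𝟭 _ := Functor.isoWhiskerLeft e.inverse (Functor.isoWhiskerLeft P' i.unitIso.symm)
      _ ≅ e.inverse ⋙ P' := Functor.isoWhiskerLeft e.inverse (Functor.rightUnitor _)⟩

/-- **`hdesc⊚` is FALSE for every `⊚`-record over `push pr₁`** (up to equivalences `e`, `i`: the data of ★ `hdesc_of_autCompatible` with
`ι := pr₁`; `G` with a proper open subgroup): descent along `baseMor` would transport (squares reversed) to descent along `push pr₁`,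
contradicting §1. ([IUTchI] Cor 5.3 (i) p.144) [cite: MochizukiFrdII2008, Ex 1.3 (ii) p.11] [claim: Mochizuki2012, status: disputed] -/
theorem GlobalFrobenioid.not_hdesc_of_pushFst {Gq : ProfiniteGrp.{u}} {Δ : GlobalDivisorData Gq} {Dcirc : Type (u + 1)}
    [Category.{u} Dcirc] {toBase0 : Dcirc ⥤ BaseCat Gq} (𝓕 : GlobalFrobenioid Δ Dcirc toBase0)
    {G : Type u} [Group G] [TopologicalSpace G] (V : OpenSubgroup G) (hV : ∃ g : G, g ∉ V)
    (e : Dcirc ≌ CosetCat (G × G)) (i : BaseCat Gq ≌ CosetCat G)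
    (hinst : toBase0 ⋙ i.functor ≅ e.functor ⋙ CosetCat.push (MonoidHom.fst G G) isOpenMap_fst) :
    ¬ ∀ Θ : Dcirc ≌ Dcirc, ∃ ΘB : 𝓕.Base ≌ 𝓕.Base, Nonempty (Θ.functor ⋙ 𝓕.baseMor ≅ 𝓕.baseMor ⋙ ΘB.functor) := by
  intro hdesc
  obtain ⟨cA⟩ := CatIsomorphism.nonempty_compat_symm toBase0 𝓕.baseMor 𝓕.α₁ 𝓕.identify 𝓕.compat.symm
  have h0 : ∀ Θ : Dcirc ≌ Dcirc, ∃ Θ₀ : BaseCat Gq ≌ BaseCat Gq, Nonempty (Θ.functor ⋙ toBase0 ≅ toBase0 ⋙ Θ₀.functor) :=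
    CatIsomorphism.descends_of_equivalences 𝓕.baseMor toBase0 𝓕.α₁.symm 𝓕.identify.symm cA hdesc
  obtain ⟨cB⟩ := CatIsomorphism.nonempty_compat_symm (CosetCat.push (MonoidHom.fst G G) isOpenMap_fst) toBase0 e i hinst
  exact CosetCat.not_forall_descends_push_fst V hV (CatIsomorphism.descends_of_equivalences toBase0 _ e.symm i.symm cB h0)

/-- **`hdesc⊚` REFUTED AS TYPED at the `pr₁` push carrier `ℬ(G_F × G_F)⁰ ⥤ ℬ(G_F)⁰`** (literal carrier of ★ `GlobalFrobenioidsPushCarrierGaloisRich`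
§4 with `H := G_F × G_F`, `ι := pr₁`, a continuous open SURJECTION): EVERY `Δ`, EVERY record, NO hypothesis.  OUR carrier; print's `ι` is an
open injection. ([IUTchI] Cor 5.3 (i) p.144) [cite: MochizukiFrdII2008, Ex 1.3 (ii) p.11] [claim: Mochizuki2012, status: disputed] -/
theorem Cor53.not_hdesc_fstPushCarrier (F : Type) [Field F] [NumberField F] {Δ : GlobalDivisorData (absGalGrp F)}
    (𝓕 : GlobalFrobenioid Δ (BaseCat (ProfiniteGrp.of (absGalGrp F × absGalGrp F)))
      (baseToCoset (ProfiniteGrp.of (absGalGrp F × absGalGrp F)) ⋙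
        CosetCat.push (MonoidHom.fst (absGalGrp F) (absGalGrp F)) isOpenMap_fst ⋙ cosetToBase (absGalGrp F))) :
    ¬ ∀ Θ : BaseCat (ProfiniteGrp.of (absGalGrp F × absGalGrp F)) ≌ BaseCat (ProfiniteGrp.of (absGalGrp F × absGalGrp F)),
        ∃ ΘB : 𝓕.Base ≌ 𝓕.Base, Nonempty (Θ.functor ⋙ 𝓕.baseMor ≅ 𝓕.baseMor ⋙ ΘB.functor) := by
  -- a proper open subgroup of `G_F`: `Gal(F̄/F(√p))` (abc-iut-L4's ★ `infinite_setOf_isOpen_index_two_gal`)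
  obtain ⟨V, hVo, hVi⟩ := (Literature.AnabelianGeometry.AbsoluteAnabelian.infinite_setOf_isOpen_index_two_gal F).nonempty
  have hV : ∃ g : absGalGrp F, g ∉ (⟨V, hVo⟩ : OpenSubgroup (absGalGrp F)) := not_forall.mp fun hall => by
    rw [(Subgroup.eq_top_iff' V).mpr fun g => hall g, Subgroup.index_top] at hVi
    exact absurd hVi (by norm_num)
  haveI := BCat.connectedToBTemp_isEquivalence (ProfiniteGrp.of (absGalGrp F × absGalGrp F))
  haveI := BCat.connectedToBTemp_isEquivalence (absGalGrp F)
  haveI := CosetCat.toConnected_isEquivalence (IsTempered.of_profinite (G := absGalGrp F))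
  let j := (cosetToBase (absGalGrp F)).asEquivalence
  refine 𝓕.not_hdesc_of_pushFst _ hV (baseToCoset (ProfiniteGrp.of (absGalGrp F × absGalGrp F))).asEquivalence j.symm ?_
  exact Functor.associator _ _ _ ≪≫ Functor.isoWhiskerLeft _
    (Functor.associator _ _ _ ≪≫ Functor.isoWhiskerLeft _ j.unitIso.symm ≪≫ Functor.rightUnitor _)

end Literature.IUT.HodgeTheaters
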